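import Mathlib
import HarnessLib
import Literature.MathematicalPhysics.StatisticalMechanics.AbkmPackageSlots
import Literature.MathematicalPhysics.StatisticalMechanics.AbkmPackageLargeSetMargin
import Literature.MathematicalPhysics.StatisticalMechanics.AbkmTwoKernelHolderPair
import Literature.MathematicalPhysics.StatisticalMechanics.LinearisedMapKernelSubUnifTorusFRD
import Literature.MathematicalPhysics.StatisticalMechanics.LinearisedMapABKMContractionGain
import Literature.MathematicalPhysics.StatisticalMechanics.TorusFRDStepKernelPair

/-!
# [ABKM19] Lemma 12.6 (12.53), LINEAR PART, for EVERY package with an `N`-FREE constant: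
# `‖C_k^{(q')}K − C_k^{(q)}K‖_{k+1} ≤ ℓ_C(P) · |q' − q|₁ · ‖K‖_k`

The two-kernel comparison of the linearised RG map `C_k^{(q)} = opC` (block part + large part) in the tuning
parameter is in the tree with a volume-uniform constant for ONE set of torus data and explicit Hölder / large-set
side conditions (`LinearisedMapKernelSubUnifTorusFRD.weakNormLE_opC_sub_unif_of_torusFRD`, p822871: per-block
constant `κ' = 2^d A_𝒫(ρ'')^{1/p}`, conditions `κ' ≤ A` and `2^{L^d} κ' A^{−(1−η⁻¹)} ≤ 1`).  This file discharges
ALL side conditions from the fields of an [ABKM19] package `P : PackageData d` (`AbkmPackageSlots`) — the Hölder pair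
with `A_𝒫(ρ'')^{1/p} ≤ 2A_𝒫'` (`AbkmTwoKernelHolderPair`), the large-set conditions at `κ' ≤ 2^{d+1}max(1,A_𝒫')` from
`hc3A` (`AbkmPackageLargeSetMargin`), the closure gain (`closureGain_pow`), `C^{r₀}` fluctuation integrals via the
restriction of `K` to connected polymers (the linearised map only reads those) — and bounds the constant UNIFORMLY in
the height `N` (`|q'−q|₁ ≤ 2T₀ ≤ 1`, so `e^{2K|q'−q|₁} ≤ e^{2K}`):

* **`PackageData.exists_weakNormLE_opC_sub`** — `∀ P, ∃ ℓ_C ≥ 0, ∀ N M Q, ∀ q q' ∈ ball, ∀ k + 1 ≤ N, ∀ K` admissible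
  with `‖K‖_k ≤ C`: `‖opC D_{q'} K − opC D_q K‖_{k+1} ≤ ℓ_C · |q' − q|₁ · C`.

This is the linear (`Σ₀`) piece of the `N`-free two-kernel bound of `S_k` (`TwoKernelSkBound d`, census (C3c-v));
the four remainder sums are NOT treated here.  Everything is proved; no named fact.  Use (honest scope): stub 1 of
the line `banach_two_kernel` of the child `TwoKernelSkBound` of the rung route
`Summits/HubbardSuperconductivity/…/Theses/ComplexGFFStiffness`; nothing about superconductivity in the Hubbard model.

## References
* S. Adams, S. Buchholz, R. Kotecký, S. Müller, arXiv:1910.13564 — Lemma 10.1, Lemma 10.2, Lemma 12.6 (12.53)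
  [AdamsBuchholzKoteckyMuller2019].
* S. Buchholz, J. Funct. Anal. 275 (2018), Thm 4.5 [Buchholz2016].
-/

noncomputable section

namespace Literature.MathematicalPhysics.StatisticalMechanics.GradientRG

open scoped BigOperators Classical
open Finset
open Literature.MathematicalPhysics.StatisticalMechanics.TorusPolymer
  (IsPolymer blocks blockOf closure translate isPolymer_blockOf isPolymer_translate isConn_translate
    translate_translate translate_zero mem_blocks)
open Literature.Barriers.CriticalPhenomena.LongRangePhi4.Polymer (IsConn)

variable {d : ℕ}

/-- `|q' − q|₁ ≤ |q'|₁ + |q|₁` (entrywise triangle inequality). [folklore] -/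
private theorem esum_sub_le (q q' : Matrix (Fin d) (Fin d) ℝ) : esum (q' - q) ≤ esum q' + esum q := by
  unfold esum
  rw [← Finset.sum_add_distrib]
  refine Finset.sum_le_sum fun i _ => ?_
  rw [← Finset.sum_add_distrib]
  refine Finset.sum_le_sum fun j _ => ?_
  rw [Matrix.sub_apply]
  exact abs_sub _ _

namespace PackageData

set_option maxHeartbeats 800000 in
/-- **The linear part of (12.53) for every package, `N`-free** (module docstring).
[cite: AdamsBuchholzKoteckyMuller2019, Lemma 12.6 (12.53) / Lemma 10.1 / Lemma 10.2] -/
theorem exists_weakNormLE_opC_sub (P : PackageData d) [Fact (0 < P.h)] [Fact (0 < P.L)] :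
    ∃ ℓC : ℝ, 0 ≤ ℓC ∧ ∀ (N M : ℕ) [NeZero M] (Q : PackageAt P N M) (q q' : Matrix (Fin d) (Fin d) ℝ),
      P.InBall q → P.InBall q' → ∀ k, k + 1 ≤ N →
      ∀ (K : Finset (Fin d → ZMod M) → ((Fin d → ZMod M) → ℝ) → ℂ) (C : ℝ), 0 ≤ C →
        WeakNormLE Q.normParams k K C → TransInv (P.L ^ k) K → (∀ X, ContDiff ℝ P.r₀ (K X)) →
        (∀ X, IsPolymer (P.L ^ k) X → IsConn X → IsGaugeLocal (Q.normParams.gauge k X) (K X)) →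
        WeakNormLE Q.normParams (k + 1)
          (opC (abkmStepData P.L P.R k (Q.kernels q')) K - opC (abkmStepData P.L P.R k (Q.kernels q)) K)
          (ℓC * esum (q' - q) * C) := by
  -- the Hölder pair and the per-block constant `κ' = 2^d A_𝒫(ρ'')^{1/p} ≤ 2^{d+1} max(1, A_𝒫')`
  set c₁ := traceConst d P.Mord P.R P.lam (derivSum d P.n fun θ' _ => P.Cα θ' 0) with hc₁
  have hc₁0 : 0 ≤ c₁ := traceConst_nonneg d P.Mord P.R P.hlam.le (derivSum_nonneg d P.n _)
  obtain ⟨p, qH, ρ'', hpq, hρ''0, hρ''bar, -, hpρ, hW2⟩ :=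
    exists_holderPair_weightIntConstRho_le_two_mul (c₁ := c₁) P.hθbar P.hθ0 P.hθ hc₁0
  set κ := weightIntConstRho P.θbar ρ'' c₁ ^ (1 / p) with hκdef
  have hW0 : 0 ≤ weightIntConstRho P.θbar ρ'' c₁ :=
    zero_le_one.trans (one_le_weightIntConstRho P.hθbar hρ''0 hρ''bar hc₁0)
  have hκ0 : 0 ≤ κ := Real.rpow_nonneg hW0 _
  set κ' := (2 : ℝ) ^ d * κ with hκ'def
  have hκ'0 : 0 ≤ κ' := by positivity
  have hκ'le : κ' ≤ (2 : ℝ) ^ (d + 1) * max 1 P.A𝒫' := by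
    have h1 : κ ≤ 2 * P.A𝒫' := by rw [← P.hA𝒫']; exact hW2
    have h2 : P.A𝒫' ≤ max 1 P.A𝒫' := le_max_right _ _
    rw [hκ'def, pow_succ]
    nlinarith [pow_nonneg (by norm_num : (0 : ℝ) ≤ 2) d]
  have hκA : κ' ≤ P.A := P.kappa'_le_A hκ'0 hκ'le
  have hsmall := P.hsmall_margin hκ'0 hκ'le
  set η : ℝ := 1 + 1 / ((2 * (2 ^ d + 1) + 6 : ℝ) ^ d) with hη
  have hη0 : 0 < η := by positivity
  -- the `N`-free constant
  have hL0 : (0 : ℝ) < P.L := by exact_mod_cast P.hLodd.pos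
  set Ksh := shellRatioConst P.c (P.Cℓ 1) (P.L : ℝ) d P.ñ with hKsh
  have hKsh0 : 0 ≤ Ksh := shellRatioConst_nonneg P.hc P.hC1 hL0.le d P.ñ
  set sq := Real.sqrt ((3 : ℝ) ^ (d + 1) * (((2 * ((2 * (2 ^ d + P.R) + 2 * P.pT + 1) + 1) : ℕ) : ℝ)) ^ d)
    with hsq
  have hsq0 : 0 ≤ sq := Real.sqrt_nonneg _
  have hqH0 : 0 ≤ qH := le_of_lt (lt_trans one_pos hpq.symm.lt)
  set ℓ₁ := ((P.r₀ : ℝ) + 1) * (8 * qH * (sq * (Real.exp (2 * Ksh) * Ksh))) with hℓ₁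
  have hℓ₁0 : 0 ≤ ℓ₁ := by positivity
  have hcc0 : 0 ≤ abkmContrConst d P.L P.R := by
    have hsr : 0 ≤ scaleRatio d P.L := (scaleRatio_pos (d := d) P.hLodd.pos).le
    unfold abkmContrConst
    exact mul_nonneg (by norm_num) (blockContrConst_nonneg d one_pos hsr zero_le_one hL0 hL0 hsr
      (by positivity) (by positivity))
  have hlpe0 : 0 ≤ largePartEps d P.L P.A κ' η := largePartEps_nonneg d P.L P.A_pos.le hκ'0
  set ℓC := ℓ₁ * ((P.L : ℝ) ^ d * κ' * abkmContrConst d P.L P.R + largePartEps d P.L P.A κ' η) with hℓC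
  have hℓC0 : 0 ≤ ℓC := by positivity
  refine ⟨ℓC, hℓC0, ?_⟩
  intro N M _ Q q q' hq hq' k hk K C hC hK hKt hKd hKloc
  -- preliminaries at height `N`
  have hA0 : 0 < P.A := P.A_pos
  have hMo : Odd M := by rw [Q.hM]; exact P.hLodd.pow
  have hsodd : Odd (P.L ^ k) := P.hLodd.pow
  obtain ⟨t', ht'⟩ : ∃ t', N = k + t' := ⟨N - k, by omega⟩
  have hMt : M = P.L ^ k * P.L ^ t' := by rw [← pow_add, ← ht']; exact Q.hM
  have htodd : Odd (P.L ^ t') := P.hLodd.pow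
  have h8 : 8 ≤ 2 ^ (d + 3) := by
    calc 8 = 2 ^ 3 := by norm_num
      _ ≤ 2 ^ (d + 3) := Nat.pow_le_pow_right (by norm_num) (by omega)
  have h2d : 2 ^ d + 1 ≤ 2 ^ (d + 3) := by
    have : 2 ^ d ≤ 2 ^ (d + 2) := Nat.pow_le_pow_right (by norm_num) (by omega)
    have e : 2 ^ (d + 3) = 2 * 2 ^ (d + 2) := by rw [pow_succ]; ring
    have h1 : 1 ≤ 2 ^ (d + 2) := Nat.one_le_two_pow
    omega
  have hL2 : 2 ^ d + 1 ≤ P.L := le_trans h2d (le_trans (Nat.le_add_right _ _) P.hL)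
  have hL4 : 4 ≤ P.L := by have := P.hL; omega
  have hgain : ∀ X : Finset (Fin d → ZMod M), IsPolymer (P.L ^ k) X → IsConn X →
      2 ^ d < (blocks (P.L ^ k) X).card →
        η * ((blocks (P.L * P.L ^ k) (closure (P.L * P.L ^ k) X)).card : ℝ) ≤ (blocks (P.L ^ k) X).card :=
    fun X hX hc hl => closureGain_pow P.hLodd hL2 hL4 Q.hM hk hX hc hl
  have hSa := stepKernelBounds_family_of_torusFRD P.hd P.hMord P.hMR P.hLodd P.hL P.hθbar P.hlam P.hn P.hn2
    P.hnñ P.hc P.hC1 Q.hallA Q.hB P.hθ0 P.hθ P.hT₀ P.hKT₀ hq'.1 hq'.2 k hk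
  have hSb := stepKernelBounds_family_of_torusFRD P.hd P.hMord P.hMR P.hLodd P.hL P.hθbar P.hlam P.hn P.hn2
    P.hnñ P.hc P.hC1 Q.hallA Q.hB P.hθ0 P.hθ P.hT₀ P.hKT₀ hq.1 hq.2 k hk
  -- restrict `K` to connected `k`-polymers (the linearised map only reads those)
  set K' : Finset (Fin d → ZMod M) → ((Fin d → ZMod M) → ℝ) → ℂ :=
    fun X => if IsPolymer (P.L ^ k) X ∧ IsConn X then K X else 0 with hK'def
  have hK'eq : ∀ X, IsPolymer (P.L ^ k) X → IsConn X → K' X = K X := fun X hX hc => by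
    show (if IsPolymer (P.L ^ k) X ∧ IsConn X then K X else 0) = K X
    exact if_pos ⟨hX, hc⟩
  have hK'ne : ∀ X, ¬ (IsPolymer (P.L ^ k) X ∧ IsConn X) → K' X = 0 := fun X hX => by
    show (if IsPolymer (P.L ^ k) X ∧ IsConn X then K X else 0) = 0
    exact if_neg hX
  have hK' : WeakNormLE Q.normParams k K' C := fun X hX hc => by rw [hK'eq X hX hc]; exact hK X hX hc
  have hK'd : ∀ X, ContDiff ℝ P.r₀ (K' X) := fun X => by
    by_cases hX : IsPolymer (P.L ^ k) X ∧ IsConn X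
    · rw [hK'eq X hX.1 hX.2]; exact hKd X
    · rw [hK'ne X hX]; exact contDiff_const
  have hK'loc : ∀ X, IsPolymer (P.L ^ k) X → IsConn X → IsGaugeLocal (Q.normParams.gauge k X) (K' X) :=
    fun X hX hc => by rw [hK'eq X hX hc]; exact hKloc X hX hc
  have hR'd : ∀ (q₀ : Matrix (Fin d) (Fin d) ℝ), P.InBall q₀ →
      ∀ X, ContDiff ℝ P.r₀ (fluct (Q.kernels q₀ (k + 1)) (K' X)) := fun q₀ hq₀ X => by
    by_cases hX : IsPolymer (P.L ^ k) X ∧ IsConn X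
    · rw [hK'eq X hX.1 hX.2]
      have hS := stepKernelBounds_family_of_torusFRD P.hd P.hMord P.hMR P.hLodd P.hL P.hθbar P.hlam P.hn P.hn2
        P.hnñ P.hc P.hC1 Q.hallA Q.hB P.hθ0 P.hθ P.hT₀ P.hKT₀ hq₀.1 hq₀.2 k hk
      exact contDiff_fluct_of_weakNormLE_of_stepKernelBounds (p := P.pT) Q.hB hS hA0 hC hK hKd hKloc hX.1 hX.2
    · rw [hK'ne X hX]
      have h0 : fluct (Q.kernels q₀ (k + 1)) (0 : ((Fin d → ZMod M) → ℝ) → ℂ) = fun _ => 0 := fluct_const _ 0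
      rw [h0]; exact contDiff_const
  have hK't : TransInv (P.L ^ k) K' := by
    intro a ha X φ
    by_cases hX : IsPolymer (P.L ^ k) X ∧ IsConn X
    · have hX' : IsPolymer (P.L ^ k) (translate a X) ∧ IsConn (translate a X) :=
        ⟨isPolymer_translate hMt hsodd htodd ha hX.1, isConn_translate hX.2 a⟩
      rw [hK'eq _ hX'.1 hX'.2, hK'eq X hX.1 hX.2]
      exact hKt a ha X φ
    · have hX' : ¬ (IsPolymer (P.L ^ k) (translate a X) ∧ IsConn (translate a X)) := by
        intro h'
        apply hX
        have e : translate (-a) (translate a X) = X := by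
          rw [TorusPolymer.translate_translate, add_neg_cancel, TorusPolymer.translate_zero]
        exact ⟨e ▸ isPolymer_translate hMt hsodd htodd ha.neg h'.1, e ▸ isConn_translate h'.2 (-a)⟩
      rw [hK'ne _ hX', hK'ne X hX]
      rfl
  -- `opC D K = opC D K'` for both step data
  have hopC : ∀ (q₀ : Matrix (Fin d) (Fin d) ℝ),
      opC (abkmStepData P.L P.R k (Q.kernels q₀)) K = opC (abkmStepData P.L P.R k (Q.kernels q₀)) K' := by
    intro q₀
    set D := abkmStepData P.L P.R k (Q.kernels q₀) with hD
    have hDs : D.s = P.L ^ k := rfl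
    have hDL : D.L = P.L := rfl
    have hB₀ : D.B₀ = blockOf (P.L ^ k) 0 := rfl
    have hB₀c : IsPolymer (P.L ^ k) D.B₀ ∧ IsConn D.B₀ := by
      rw [hB₀]; exact ⟨isPolymer_blockOf _ 0, TorusPolymer.isConn_blockOf hMo hsodd 0⟩
    have hopB : opB D K' = opB D K := by
      unfold opB; rw [hK'eq D.B₀ hB₀c.1 hB₀c.2]
    funext U φ
    show blockPart D K U φ + largePart D.s D.L (fluct D.𝒞) K U φ =
      blockPart D K' U φ + largePart D.s D.L (fluct D.𝒞) K' U φ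
    congr 1
    · unfold blockPart
      refine sum_congr rfl fun B hB' => ?_
      have hBb := blockPartIndex_subset_blocks D U hB'
      rw [hDs] at hBb
      obtain ⟨y, -, rfl⟩ := mem_blocks.1 hBb
      unfold blockTerm
      rw [hopB, hK'eq _ (isPolymer_blockOf _ y) (TorusPolymer.isConn_blockOf hMo hsodd y)]
    · unfold largePart
      rw [hDs, hDL]
      refine sum_congr rfl fun X hX => ?_
      obtain ⟨hXp, hXc, -, -⟩ := mem_largePartIndex.1 hX
      rw [hK'eq X hXp hXc]
  rw [hopC q', hopC q]
  -- the volume-uniform two-kernel comparison of the linearised map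
  have hW := weakNormLE_opC_sub_unif_of_torusFRD (pT := P.pT) (r₀ := P.r₀) (h := P.h) (A := P.A) P.hd P.hMord
    P.hMR P.hLodd P.hL Q.hM P.hθbar P.hlam P.hn P.hn2 P.hnñ P.hgap P.hc P.hC1 Q.hallA Q.hB hk P.hp P.hpM P.hr₀
    P.hδ₀ P.hδ₁ P.hh P.hh0 P.hA1 P.hθ0 P.hθ P.hT₀ P.hKT₀ hq.1 hq'.1 hq.2 hq'.2 hpq hρ''0 hρ''bar hpρ hκA hη0
    hsmall hgain hC hK' hK't hK'd hK'loc (hR'd q' hq') (hR'd q hq)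
  -- the constant: `|q' − q|₁ ≤ 1`, `e^{2K|q'−q|₁} ≤ e^{2K}`
  set t := esum (q' - q) with htdef
  have ht0 : 0 ≤ t := entrySum_nonneg _
  have ht1 : t ≤ 1 := by
    have h1 := esum_sub_le q q'
    have h2 : esum q' ≤ P.T₀ := hq'.2
    have h3 : esum q ≤ P.T₀ := hq.2
    linarith [P.hT₀]
  have hexp : Real.exp (2 * Ksh * t) ≤ Real.exp (2 * Ksh) := by
    apply Real.exp_le_exp.2
    nlinarith
  have hEK : t * Real.exp (2 * Ksh * t) * Ksh ≤ t * (Real.exp (2 * Ksh) * Ksh) := by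
    rw [mul_assoc]
    exact mul_le_mul_of_nonneg_left (mul_le_mul_of_nonneg_right hexp hKsh0) ht0
  set ℓt := ((P.r₀ : ℝ) + 1) * (8 * qH * (sq * (t * Real.exp (2 * Ksh * t) * Ksh))) with hℓtdef
  have hℓt : ℓt ≤ ℓ₁ * t := by
    rw [hℓtdef, hℓ₁]
    have h1 := mul_le_mul_of_nonneg_left hEK hsq0
    have h2 := mul_le_mul_of_nonneg_left h1 (by positivity : (0 : ℝ) ≤ 8 * qH)
    have h3 := mul_le_mul_of_nonneg_left h2 (by positivity : (0 : ℝ) ≤ (P.r₀ : ℝ) + 1)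
    calc ((P.r₀ : ℝ) + 1) * (8 * qH * (sq * (t * Real.exp (2 * Ksh * t) * Ksh)))
        ≤ ((P.r₀ : ℝ) + 1) * (8 * qH * (sq * (t * (Real.exp (2 * Ksh) * Ksh)))) := h3
      _ = ((P.r₀ : ℝ) + 1) * (8 * qH * (sq * (Real.exp (2 * Ksh) * Ksh))) * t := by ring
  have hLd0 : (0 : ℝ) ≤ (P.L : ℝ) ^ d := by positivity
  have h1 : (P.L : ℝ) ^ d * (ℓt * κ' * abkmContrConst d P.L P.R) ≤
      (P.L : ℝ) ^ d * ((ℓ₁ * t) * κ' * abkmContrConst d P.L P.R) :=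
    mul_le_mul_of_nonneg_left (mul_le_mul_of_nonneg_right (mul_le_mul_of_nonneg_right hℓt hκ'0) hcc0) hLd0
  have h2 : ℓt * largePartEps d P.L P.A κ' η ≤ (ℓ₁ * t) * largePartEps d P.L P.A κ' η :=
    mul_le_mul_of_nonneg_right hℓt hlpe0
  have hfin : C * ((P.L : ℝ) ^ d * (ℓt * κ' * abkmContrConst d P.L P.R) + ℓt * largePartEps d P.L P.A κ' η) ≤
      ℓC * t * C :=
    calc C * ((P.L : ℝ) ^ d * (ℓt * κ' * abkmContrConst d P.L P.R) + ℓt * largePartEps d P.L P.A κ' η)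
        ≤ C * ((P.L : ℝ) ^ d * ((ℓ₁ * t) * κ' * abkmContrConst d P.L P.R) +
            (ℓ₁ * t) * largePartEps d P.L P.A κ' η) :=
          mul_le_mul_of_nonneg_left (add_le_add h1 h2) hC
      _ = ℓC * t * C := by rw [hℓC]; ring
  exact hW.mono hA0 hfin

end PackageData

end Literature.MathematicalPhysics.StatisticalMechanics.GradientRG

end
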